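import Mathlib
import HarnessLib
import Literature.Computability.QuantumComplexity.QuantumAdvantageWave0

/-!
# Gaussian permanents: moments and weak anti-concentration (Aaronson–Arkhipov 2013, §8)

Companion to `QuantumAdvantageWave0.lean`, which states the (open) Permanent Anti-Concentration
Conjecture `PermanentAntiConcentrationConjecture` (Aaronson–Arkhipov, *The computational complexity
of linear optics*, Theory of Computing 9 (2013) 143–252, Conjecture 1.6). This file vendors what
**is proved** about the law of `Per X` for `X ∼ 𝒩(0,1)_ℂ^{n×n}` in §8 of that paper:

* `integral_id_stdComplexGaussian`, `integral_norm_sq_stdComplexGaussian`,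
  `memLp_id_stdComplexGaussian`: `𝔼 z = 0`, `𝔼 |z|² = 1`, all moments finite, for `z ∼ 𝒩(0,1)_ℂ`
  (§2, p. 161).
* `integral_norm_sq_permanent` (**proved**): `𝔼 |Per X|² = n!` (§8, p. 219, the displayed
  four-line computation), together with integrability `integrable_norm_sq_permanent`.
* `weakAntiConcentration_of_fourthMoment` (**proved**): the printed proof of Theorem 8.6
  (Weak Anti-Concentration of the Permanent, `Pr[|Per X|² ≥ α · n!] > (1-α)²/(n+1)`), a
  Paley–Zygmund argument from `𝔼 P_n = 1` and `𝔼 P_n² = n+1` (`P_n := |Per X|²/n!`), with the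
  fourth-moment identity of Lemma 8.8 (`𝔼 |Per X|⁴ = (n+1) (n!)²`) taken as an explicit
  hypothesis for the given `n`. Lemma 8.8 itself (a counting argument over `S_n⁴`) is proved in
  the sibling file `GaussianPermanentFourthMoment.lean` (with `PermanentPairingCount.lean`), which
  also records Theorem 8.6 unconditionally (`weakPermanentAntiConcentration`).

Design choices.
* Theorem 8.6 is printed "for all `α < 1`". The printed bound is false for `α ≤ 1 - √(n+1)`
  (the event is then sure and `(1-α)²/(n+1) ≥ 1`) and for `(n, α) = (0, 0)` (`P_0 ≡ 1`, so the
  claim reads `1 > 1`); the printed proof silently uses `α > 0` (strictness of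
  `𝔼[P_n ; P_n < α] < α`). We therefore state it for `0 < α < 1`, which covers every
  non-trivial instance.
* Expectations are Bochner integrals against `gaussianMatrixMeasure n`; events are measured with
  `Measure.real`, as in `PermanentAntiConcentrationConjecture`.

Not here: Theorem 8.2 (determinant anti-concentration), Theorem 8.1 (Tao–Vu, Bernoulli
permanents), §8.4 higher moments; and of course Conjecture 1.6 itself, which is open.
-/

namespace Literature.Computability.QuantumComplexity

open _root_.MeasureTheory _root_.ProbabilityTheory
open scoped ENNReal NNReal ComplexConjugate

section StdComplexGaussian

/-- Integrals against `stdComplexGaussian` are integrals against the product of two centred real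
Gaussians of variance `1/2`, read through `(x, y) ↦ x + iy`. [folklore] -/
theorem integral_stdComplexGaussian {E : Type*} [NormedAddCommGroup E] [NormedSpace ℝ E]
    (f : ℂ → E) :
    ∫ z, f z ∂stdComplexGaussian =
      ∫ p : ℝ × ℝ, f ⟨p.1, p.2⟩
        ∂((gaussianReal 0 (1 / 2 : ℝ≥0)).prod (gaussianReal 0 (1 / 2 : ℝ≥0))) := by
  unfold stdComplexGaussian
  rw [integral_map_equiv]
  rfl

/-- Second moment of a centred real Gaussian: `∫ x² d𝒩(0,v) = v`. [folklore] -/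
theorem integral_sq_gaussianReal_zero (v : ℝ≥0) : ∫ x, x ^ 2 ∂gaussianReal 0 v = v := by
  have h := variance_eq_integral (μ := gaussianReal 0 v) (X := id) measurable_id.aemeasurable
  rw [variance_id_gaussianReal] at h
  simp only [id_eq, integral_id_gaussianReal, sub_zero] at h
  exact h.symm

/-- `𝔼 z = 0` for `z ∼ 𝒩(0,1)_ℂ` (Aaronson–Arkhipov 2013, §2: "mean 0").
[cite: AaronsonArkhipovToC2013, §2 p. 161] -/
theorem integral_id_stdComplexGaussian : ∫ z, z ∂stdComplexGaussian = 0 := by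
  rw [integral_stdComplexGaussian]
  set g : Measure ℝ := gaussianReal 0 (1 / 2 : ℝ≥0) with hg
  have h1 : ∀ p : ℝ × ℝ, (⟨p.1, p.2⟩ : ℂ) = (p.1 : ℂ) + (p.2 : ℂ) * Complex.I := fun p =>
    Complex.mk_eq_add_mul_I _ _
  simp_rw [h1]
  have hint : Integrable (fun x : ℝ => (x : ℂ)) g :=
    (memLp_one_iff_integrable.mp (memLp_id_gaussianReal' (μ := 0) (v := 1 / 2) 1 (by simp))).ofReal
  have hfst : Integrable (fun p : ℝ × ℝ => (p.1 : ℂ)) (g.prod g) := hint.comp_fst g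
  have hsnd : Integrable (fun p : ℝ × ℝ => (p.2 : ℂ) * Complex.I) (g.prod g) :=
    (hint.comp_snd g).mul_const _
  have h2 : ∫ x : ℝ, (x : ℂ) ∂g = 0 := by
    rw [integral_complex_ofReal, hg, integral_id_gaussianReal, Complex.ofReal_zero]
  rw [integral_add hfst hsnd, integral_mul_const,
    integral_fun_fst (f := fun x : ℝ => (x : ℂ)), integral_fun_snd (f := fun x : ℝ => (x : ℂ))]
  simp [h2]

/-- `𝔼 |z|² = 1` for `z ∼ 𝒩(0,1)_ℂ` (Aaronson–Arkhipov 2013, §2: "variance `E[|z|²] = 1`").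
[cite: AaronsonArkhipovToC2013, §2 p. 161] -/
theorem integral_norm_sq_stdComplexGaussian : ∫ z, ‖z‖ ^ 2 ∂stdComplexGaussian = 1 := by
  rw [integral_stdComplexGaussian]
  set g : Measure ℝ := gaussianReal 0 (1 / 2 : ℝ≥0) with hg
  have h1 : ∀ p : ℝ × ℝ, ‖(⟨p.1, p.2⟩ : ℂ)‖ ^ 2 = p.1 ^ 2 + p.2 ^ 2 := fun p => by
    rw [Complex.sq_norm, Complex.normSq_mk]; ring
  simp_rw [h1]
  have hsq : Integrable (fun x : ℝ => x ^ 2) g :=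
    (memLp_id_gaussianReal' (μ := 0) (v := 1 / 2) 2 (by simp)).integrable_sq
  have hfst : Integrable (fun p : ℝ × ℝ => p.1 ^ 2) (g.prod g) := hsq.comp_fst g
  have hsnd : Integrable (fun p : ℝ × ℝ => p.2 ^ 2) (g.prod g) := hsq.comp_snd g
  rw [integral_add hfst hsnd, integral_fun_fst (f := fun x : ℝ => x ^ 2),
    integral_fun_snd (f := fun x : ℝ => x ^ 2)]
  simp only [probReal_univ, one_smul, hg, integral_sq_gaussianReal_zero]
  push_cast
  norm_num

/-- All moments of `𝒩(0,1)_ℂ` are finite: the identity is in `L^p(stdComplexGaussian)` for every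
finite `p`. [folklore] -/
theorem memLp_id_stdComplexGaussian (p : ℝ≥0∞) (hp : p ≠ ∞) :
    MemLp (fun z : ℂ => z) p stdComplexGaussian := by
  unfold stdComplexGaussian
  rw [memLp_map_measure_iff (by fun_prop) (by fun_prop)]
  set g : Measure ℝ := gaussianReal 0 (1 / 2 : ℝ≥0) with hg
  have hfst : MemLp (fun q : ℝ × ℝ => q.1) p (g.prod g) :=
    (memLp_id_gaussianReal' (μ := 0) (v := 1 / 2) p hp).comp_fst g
  have hsnd : MemLp (fun q : ℝ × ℝ => q.2) p (g.prod g) :=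
    (memLp_id_gaussianReal' (μ := 0) (v := 1 / 2) p hp).comp_snd g
  have hsum : MemLp (fun q : ℝ × ℝ => ‖q.1‖ + ‖q.2‖) p (g.prod g) := hfst.norm.add hsnd.norm
  refine hsum.mono' (by fun_prop) (ae_of_all _ fun q => ?_)
  simp only [Function.comp_apply, Complex.measurableEquivRealProd_symm_apply, Real.norm_eq_abs]
  exact Complex.norm_le_abs_re_add_abs_im _

end StdComplexGaussian

section GaussianMatrix

variable (n : ℕ)

/-- The law of one row of the Gaussian ensemble: `n` i.i.d. `𝒩(0,1)_ℂ` entries, so that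
`gaussianMatrixMeasure n = Measure.pi (fun _ ↦ gaussianRowMeasure n)` definitionally.
[cite: AaronsonArkhipovToC2013, §2 p. 161] -/
noncomputable abbrev gaussianRowMeasure : Measure (Fin n → ℂ) :=
  Measure.pi fun _ : Fin n => stdComplexGaussian

/-- `gaussianMatrixMeasure` is the product over rows of `gaussianRowMeasure`. [folklore] -/
theorem gaussianMatrixMeasure_eq_pi :
    gaussianMatrixMeasure n = Measure.pi (fun _ : Fin n => gaussianRowMeasure n) := rfl

/-- Each coordinate of a Gaussian row is in `L^p` for every finite `p`. [folklore] -/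
theorem memLp_eval_gaussianRowMeasure (a : Fin n) (p : ℝ≥0∞) (hp : p ≠ ∞) :
    MemLp (fun r : Fin n → ℂ => r a) p (gaussianRowMeasure n) :=
  (memLp_id_stdComplexGaussian p hp).comp_measurePreserving
    (measurePreserving_eval (fun _ : Fin n => stdComplexGaussian) a)

/-- Independence of distinct coordinates under a finite product of probability measures, in the
form `𝔼[f(x_a) g(x_b)] = 𝔼 f(x_a) · 𝔼 g(x_b)` for `a ≠ b`. [folklore] -/
theorem integral_pi_eval_mul_eval_of_ne {ι Ω 𝕜 : Type*} [Fintype ι] [DecidableEq ι] [RCLike 𝕜]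
    {mΩ : MeasurableSpace Ω} (μ : ι → Measure Ω) [∀ i, IsProbabilityMeasure (μ i)] {a b : ι}
    (hab : a ≠ b) (f g : Ω → 𝕜) :
    ∫ x, f (x a) * g (x b) ∂Measure.pi μ = (∫ y, f y ∂μ a) * ∫ y, g y ∂μ b := by
  let F : ι → Ω → 𝕜 := fun j => if j = a then f else if j = b then g else fun _ => 1
  have hFa : F a = f := by simp [F]
  have hFb : F b = g := by simp [F, hab.symm]
  have hF : ∀ c, c ≠ a ∧ c ≠ b → F c = fun _ => 1 := fun c hc => by simp [F, hc.1, hc.2]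
  have h1 : ∀ x : ι → Ω, f (x a) * g (x b) = ∏ j, F j (x j) := fun x => by
    rw [Finset.prod_eq_mul a b hab (fun c _ hc => by rw [hF c hc]) (by simp) (by simp), hFa, hFb]
  simp_rw [h1, integral_fintype_prod_eq_prod]
  rw [Finset.prod_eq_mul a b hab (fun c _ hc => by rw [hF c hc]; simp) (by simp) (by simp), hFa, hFb]

/-- Second moments of the entries of a Gaussian row: `𝔼[x_a conj(x_b)] = δ_{ab}`.
[cite: AaronsonArkhipovToC2013, §8 p. 219] -/
theorem integral_eval_mul_conj_eval (a b : Fin n) :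
    ∫ r, r a * conj (r b) ∂gaussianRowMeasure n = if a = b then 1 else 0 := by
  split_ifs with hab
  · subst hab
    have h1 : ∀ r : Fin n → ℂ, r a * conj (r a) = ((‖r a‖ ^ 2 : ℝ) : ℂ) := fun r => by
      rw [Complex.mul_conj, Complex.normSq_eq_norm_sq]
    simp_rw [h1, integral_complex_ofReal]
    rw [integral_comp_eval (μ := fun _ : Fin n => stdComplexGaussian) (i := a)
      (f := fun z : ℂ => ‖z‖ ^ 2) (by fun_prop), integral_norm_sq_stdComplexGaussian]
    simp
  · rw [integral_pi_eval_mul_eval_of_ne (fun _ : Fin n => stdComplexGaussian) hab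
      (fun z : ℂ => z) (fun z : ℂ => conj z), integral_id_stdComplexGaussian, zero_mul]

/-- Row expansion of the permanent of `Matrix.of X`: `Per X = ∑_σ ∏_i X i (σ i)`. [folklore] -/
theorem permanent_of_eq_sum (X : Fin n → Fin n → ℂ) :
    (Matrix.of X).permanent = ∑ σ : Equiv.Perm (Fin n), ∏ i, X i (σ i) := by
  rw [← Matrix.permanent_transpose]
  simp [Matrix.permanent]

/-- `X ↦ Per X` is continuous on `ℂ^{n×n}`. [folklore] -/
theorem continuous_permanent_of :
    Continuous fun X : Fin n → Fin n → ℂ => (Matrix.of X).permanent := by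
  unfold Matrix.permanent
  fun_prop

/-- Expansion `|Per X|² = ∑_{σ,τ} ∏_i X_{i,σ(i)} conj(X_{i,τ(i)})` (Aaronson–Arkhipov 2013, §8,
first line of the computation of `𝔼 |Per X|²`). [cite: AaronsonArkhipovToC2013, §8 p. 219] -/
theorem norm_sq_permanent_eq_sum (X : Fin n → Fin n → ℂ) :
    ((‖(Matrix.of X).permanent‖ ^ 2 : ℝ) : ℂ) =
      ∑ σ : Equiv.Perm (Fin n), ∑ τ : Equiv.Perm (Fin n), ∏ i, (X i (σ i) * conj (X i (τ i))) := by
  rw [← Complex.normSq_eq_norm_sq, ← Complex.mul_conj, permanent_of_eq_sum, map_sum,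
    Finset.sum_mul_sum]
  refine Finset.sum_congr rfl fun σ _ => Finset.sum_congr rfl fun τ _ => ?_
  rw [map_prod, ← Finset.prod_mul_distrib]

/-- Each term `∏_i X_{i,σ(i)} conj(X_{i,τ(i)})` is integrable against the Gaussian ensemble
(rows are independent and entries have finite second moments). [folklore] -/
theorem integrable_perm_term (σ τ : Equiv.Perm (Fin n)) :
    Integrable (fun X : Fin n → Fin n → ℂ => ∏ i, (X i (σ i) * conj (X i (τ i))))
      (gaussianMatrixMeasure n) := by
  rw [gaussianMatrixMeasure_eq_pi]
  refine Integrable.fintype_prod (f := fun i (r : Fin n → ℂ) => r (σ i) * conj (r (τ i)))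
    (fun i => ?_)
  have h1 := memLp_eval_gaussianRowMeasure n (σ i) 2 (by simp)
  have h2 : MemLp (fun r : Fin n → ℂ => conj (r (τ i))) 2 (gaussianRowMeasure n) :=
    (memLp_eval_gaussianRowMeasure n (τ i) 2 (by simp)).of_le
      (Continuous.aestronglyMeasurable (by fun_prop)) (ae_of_all _ fun r => by simp)
  exact h1.integrable_mul h2

/-- `𝔼 ∏_i X_{i,σ(i)} conj(X_{i,τ(i)}) = [σ = τ]` (Aaronson–Arkhipov 2013, §8, second and third
lines of the computation of `𝔼 |Per X|²`). [cite: AaronsonArkhipovToC2013, §8 p. 219] -/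
theorem integral_perm_term (σ τ : Equiv.Perm (Fin n)) :
    ∫ X, ∏ i, (X i (σ i) * conj (X i (τ i))) ∂gaussianMatrixMeasure n =
      if σ = τ then 1 else 0 := by
  rw [gaussianMatrixMeasure_eq_pi,
    integral_fintype_prod_eq_prod (f := fun i (r : Fin n → ℂ) => r (σ i) * conj (r (τ i)))]
  simp_rw [integral_eval_mul_conj_eval]
  rw [Finset.prod_boole]
  by_cases h : σ = τ
  · subst h; simp
  · have h' : ¬ ∀ i ∈ (Finset.univ : Finset (Fin n)), σ i = τ i :=
      fun hall => h (Equiv.ext fun i => hall i (Finset.mem_univ i))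
    rw [if_neg h', if_neg h]

/-- **Second moment of the Gaussian permanent** (Aaronson–Arkhipov 2013, §8, p. 219):
`𝔼_{X ∼ 𝒩(0,1)_ℂ^{n×n}} |Per X|² = n!`. [cite: AaronsonArkhipovToC2013, §8 p. 219] -/
theorem integral_norm_sq_permanent :
    ∫ X, ‖(Matrix.of X).permanent‖ ^ 2 ∂gaussianMatrixMeasure n = n.factorial := by
  apply Complex.ofReal_injective
  rw [← integral_complex_ofReal]
  simp_rw [norm_sq_permanent_eq_sum]
  rw [integral_finsetSum _
    (fun σ _ => integrable_finsetSum _ (fun τ _ => integrable_perm_term n σ τ))]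
  simp_rw [integral_finsetSum _ (fun τ _ => integrable_perm_term n _ τ), integral_perm_term]
  simp [Finset.sum_ite_eq, Fintype.card_perm]

/-- `|Per X|²` is integrable against the Gaussian ensemble. [folklore] -/
theorem integrable_norm_sq_permanent :
    Integrable (fun X : Fin n → Fin n → ℂ => ‖(Matrix.of X).permanent‖ ^ 2)
      (gaussianMatrixMeasure n) := by
  have h : Integrable (fun X : Fin n → Fin n → ℂ => ((‖(Matrix.of X).permanent‖ ^ 2 : ℝ) : ℂ))
      (gaussianMatrixMeasure n) := by
    simp_rw [norm_sq_permanent_eq_sum]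
    exact integrable_finsetSum _ fun σ _ =>
      integrable_finsetSum _ fun τ _ => integrable_perm_term n σ τ
  have h' := h.re
  simp only [RCLike.re_to_complex, Complex.ofReal_re] at h'
  exact h'

end GaussianMatrix

section WeakPACC

/-- **Theorem 8.6 of Aaronson–Arkhipov 2013 from its Lemma 8.8** (Weak Anti-Concentration of
the Permanent, §8.3, p. 224, eq. (8.42), proof p. 227). Assume the fourth-moment identity of
Lemma 8.8 for the given `n`, `𝔼_{X ∼ 𝒩(0,1)_ℂ^{n×n}} |Per X|⁴ = (n+1) · (n!)²` (i.e.
`𝔼[P_n²] = n+1` for `P_n := |Per X|²/n!`; as a Bochner integral this hypothesis also carries the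
integrability of `|Per X|⁴`). Then for `0 < α < 1`,
`Pr[|Per X|² ≥ α · n!] > (1-α)²/(n+1)`.
The proof is the printed Paley–Zygmund argument: with `F = {P_n ≥ α}` and `δ = Pr[F]`,
`1 = 𝔼 P_n ≤ 𝔼[P_n; F] + α(1-δ)` and Cauchy–Schwarz `𝔼[P_n; F]² ≤ 𝔼[P_n²] δ = (n+1) δ`, whence
`δ > (1-α)²/(n+1)`.
Printed "for all `α < 1`"; stated for `0 < α < 1`: for `α ≤ 0` the event is sure while the
printed bound can exceed `1` (e.g. `α ≤ 1 - √(n+1)`), and for `(n, α) = (0, 0)` it reads `1 > 1`;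
the printed proof uses `α > 0`. [cite: AaronsonArkhipovToC2013, Thm 8.6 p. 224 (proof p. 227)] -/
theorem weakAntiConcentration_of_fourthMoment (n : ℕ)
    (h4 : ∫ X, ‖(Matrix.of X).permanent‖ ^ 4 ∂gaussianMatrixMeasure n =
      ((n : ℝ) + 1) * ((n.factorial : ℝ)) ^ 2)
    (α : ℝ) (hα0 : 0 < α) (hα1 : α < 1) :
    (1 - α) ^ 2 / ((n : ℝ) + 1) <
      (gaussianMatrixMeasure n).real
        {X | α * (n.factorial : ℝ) ≤ ‖(Matrix.of X).permanent‖ ^ 2} := by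
  set μ := gaussianMatrixMeasure n with hμ
  set f : (Fin n → Fin n → ℂ) → ℝ := fun X => ‖(Matrix.of X).permanent‖ ^ 2 with hf
  set c : ℝ := (n.factorial : ℝ) with hc
  have hc0 : 0 < c := by rw [hc]; exact_mod_cast Nat.factorial_pos n
  have hf0 : ∀ X, 0 ≤ f X := fun X => by positivity
  have hfm : Measurable f :=
    ((continuous_permanent_of n).norm.pow 2).measurable
  have hfi : Integrable f μ := integrable_norm_sq_permanent n
  have hf1 : ∫ X, f X ∂μ = c := integral_norm_sq_permanent n
  have hf2 : ∫ X, f X ^ 2 ∂μ = ((n : ℝ) + 1) * c ^ 2 := by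
    simp_rw [hf, ← pow_mul]
    simpa using h4
  have hf4i : Integrable (fun X => f X ^ 2) μ := by
    refine Integrable.of_integral_ne_zero ?_
    rw [hf2]; positivity
  have hmem : MemLp f 2 μ := (memLp_two_iff_integrable_sq hfi.aestronglyMeasurable).mpr hf4i
  set A : Set (Fin n → Fin n → ℂ) := {X | α * c ≤ f X} with hA
  have hAm : MeasurableSet A := measurableSet_le measurable_const hfm
  set δ : ℝ := μ.real A with hδ
  have hδ0 : 0 ≤ δ := measureReal_nonneg
  -- (1) split the first moment over `A` and `Aᶜ`
  have hsplit : ∫ X in A, f X ∂μ + ∫ X in Aᶜ, f X ∂μ = c := by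
    rw [integral_add_compl hAm hfi, hf1]
  -- (2) on `Aᶜ` the integrand is below `α c`
  have hAc : ∫ X in Aᶜ, f X ∂μ ≤ α * c * (1 - δ) := by
    have hcompl : μ.real Aᶜ = 1 - δ := probReal_compl_eq_one_sub hAm
    calc ∫ X in Aᶜ, f X ∂μ ≤ ∫ X in Aᶜ, α * c ∂μ :=
          setIntegral_mono_on hfi.integrableOn (integrableOn_const (by simp)) hAm.compl
            (fun X hX => le_of_lt (not_le.mp hX))
      _ = α * c * (1 - δ) := by rw [setIntegral_const, smul_eq_mul, hcompl, mul_comm]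
  -- (3) Cauchy–Schwarz on `A`
  have hCS : (∫ X in A, f X ∂μ) ^ 2 ≤ (∫ X in A, f X ^ 2 ∂μ) * δ := by
    have hpq : Real.HolderConjugate 2 2 := Real.HolderConjugate.two_two
    have hmemA : MemLp f (ENNReal.ofReal 2) (μ.restrict A) := by
      rw [ENNReal.ofReal_ofNat]; exact hmem.restrict A
    have hone : MemLp (fun _ : Fin n → Fin n → ℂ => (1 : ℝ)) (ENNReal.ofReal 2) (μ.restrict A) :=
      memLp_const 1
    have key := integral_mul_le_Lp_mul_Lq_of_nonneg hpq (ae_of_all _ fun X => hf0 X)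
      (ae_of_all _ fun _ => zero_le_one) hmemA hone
    simp only [mul_one, one_pow, Real.rpow_two, integral_const, smul_eq_mul] at key
    have hB0 : 0 ≤ ∫ X in A, f X ^ 2 ∂μ := integral_nonneg fun X => by positivity
    have hI0 : 0 ≤ ∫ X in A, f X ∂μ := integral_nonneg fun X => hf0 X
    have hδ' : (μ.restrict A).real Set.univ = δ := by
      rw [hδ, measureReal_restrict_apply_univ]
    rw [hδ'] at key
    calc (∫ X in A, f X ∂μ) ^ 2
        ≤ ((∫ X in A, f X ^ 2 ∂μ) ^ (1 / 2 : ℝ) * δ ^ (1 / 2 : ℝ)) ^ 2 :=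
          pow_le_pow_left₀ hI0 key 2
      _ = (∫ X in A, f X ^ 2 ∂μ) * δ := by
          rw [mul_pow, ← Real.rpow_natCast ((∫ X in A, f X ^ 2 ∂μ) ^ (1 / 2 : ℝ)),
            ← Real.rpow_natCast (δ ^ (1 / 2 : ℝ)), ← Real.rpow_mul hB0, ← Real.rpow_mul hδ0]
          norm_num
  -- (4) the restricted second moment is at most the full one
  have h4le : ∫ X in A, f X ^ 2 ∂μ ≤ ((n : ℝ) + 1) * c ^ 2 := by
    rw [← hf2]
    exact setIntegral_le_integral hf4i (ae_of_all _ fun X => by positivity)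
  -- (5) algebra
  have hIA : c * (1 - α) + α * c * δ ≤ ∫ X in A, f X ∂μ := by linarith
  have hpos : 0 < c * (1 - α) := mul_pos hc0 (by linarith)
  have hI2 : (∫ X in A, f X ∂μ) ^ 2 ≤ ((n : ℝ) + 1) * c ^ 2 * δ := by
    calc (∫ X in A, f X ∂μ) ^ 2 ≤ (∫ X in A, f X ^ 2 ∂μ) * δ := hCS
      _ ≤ ((n : ℝ) + 1) * c ^ 2 * δ := mul_le_mul_of_nonneg_right h4le hδ0
  have hδpos : 0 < δ := by
    by_contra hneg
    have hδz : δ = 0 := le_antisymm (not_lt.mp hneg) hδ0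
    have h1 : c * (1 - α) ≤ ∫ X in A, f X ∂μ := by nlinarith
    have h2 : (c * (1 - α)) ^ 2 ≤ (∫ X in A, f X ∂μ) ^ 2 := pow_le_pow_left₀ hpos.le h1 2
    rw [hδz, mul_zero] at hI2
    nlinarith
  have hIlt : c * (1 - α) < ∫ X in A, f X ∂μ := by nlinarith [mul_pos (mul_pos hα0 hc0) hδpos]
  have hsq : (c * (1 - α)) ^ 2 < (∫ X in A, f X ∂μ) ^ 2 := pow_lt_pow_left₀ hIlt hpos.le two_ne_zero
  have hfin : (c * (1 - α)) ^ 2 < ((n : ℝ) + 1) * c ^ 2 * δ := lt_of_lt_of_le hsq hI2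
  have hn1 : (0 : ℝ) < (n : ℝ) + 1 := by positivity
  rw [div_lt_iff₀ hn1]
  have hc2 : 0 < c ^ 2 := by positivity
  nlinarith [hfin, hc2]

end WeakPACC

end Literature.Computability.QuantumComplexity
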